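import Summits.CriticalPhenomena.Ising3DConformalLimit.Theorems.IsingEuclidUpgradeIsingEuclidUpgradeR2RotInvPowerLawTowerRays
import Summits.CriticalPhenomena.Ising3DConformalLimit.Theorems.HarmonicMomentsIsotropyTwoPointAsymptoticIsotropyOfRayRatios
import Summits.CriticalPhenomena.Ising3DConformalLimit.Theses.MonotoneRG
import Summits.CriticalPhenomena.Ising3DConformalLimit.Theses.HelsonAxis
import Literature.Probability.LatticeModels.IsingExponents
import HarnessLib

/-!
# Crux `IsingEuclidUpgradeR2RotInvPowerLaw` (stmt-CriticalPhenomena-0634), line `tower_profile_rigidity`: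
# the MONOTONE-RG LINK — item 14454 `ZoomMonotone` ⇒ Sray, and 14454 ∧ 4662 `EtaBoundsExist` ⇒ T1 ⇒ r2

Write `G := criticalTwoPoint 3` for the critical two-point function `⟨σ₀σ_x⟩_{β_c}` of the
nearest-neighbour Ising model on `ℤ³` and `g(n) := G(n e₀)`. The landed radial glue of this line
(`…R2RotInvPowerLawTowerRays.lean`) says `r2 ⟺ T1 ∧ Sray`, where

* T1 (dyadic tower law) `∃ Δ c > 0, g(2^j)·(2^j)^{2Δ} → c`;
* Sray (ray dilation law) `∃ Δ ∀ v ≠ 0 ∀ k ≥ 1, G(knv)·k^{2Δ}/G(nv) → 1`.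

This file links both radial children to route `MonotoneRG`'s crux `ZoomMonotone` (item
stmt-CriticalPhenomena-14454: at every integer non-coincident configuration the self-normalised critical
zoom `m ↦ ⟨∏σ_{m xᵢ}⟩/g(m)^{n/2}` is eventually monotone in `m`) and to route `HelsonAxis`' crux
`EtaBoundsExist` (item stmt-CriticalPhenomena-4662: `c‖x‖^{-(1+η)} ≤ G(x) ≤ C‖x‖^{-(1+η)}`):

* `rayDilationLaw_of_zoomMonotone : ZoomMonotone → Sray`. By the tree, `ZoomMonotone` alone gives the
  scale-covariant continuum limit of all critical correlators (`crux_of_zoomMonotone`, eventually monotone +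
  bounded ⇒ convergent at integer meshes, doubling from the one pair `(0, 2e₀)`, two hierarchies), any pair
  scaling limit gives ray regular variation `G(kmx)/G(mx) → k^{-a}` (`rayRV_of_existsScaleCovariantLimit`),
  and that is Sray with `Δ = a/2` (`rayLaw_of_rayRV`).
* `towerLaw_of_zoomMonotone_of_etaBounds : ZoomMonotone → EtaBoundsExist → T1`. With `κ := 1 + η` put
  `u_j := g(2^j)(2^j)^κ ∈ [c, C]`; `u_{j+1} = r_j u_j` with `r_j = 2^κ · g(2^{j+1})/g(2^j)`, and
  `g(2m)/g(m)` is EXACTLY the self-normalised pair zoom at `(0, 2e₀)` and mesh `1/m`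
  (`rescaled_pin_cfg0s`), so `r_j` is eventually monotone by `ZoomMonotone`. A positive sequence pinched in
  `[c, C]` whose successive ratios are eventually monotone is itself eventually monotone (if the ratios are
  nondecreasing and one exceeds `1`, the sequence blows up geometrically; dually), hence converges to a limit
  `≥ c > 0`: T1 with `Δ = κ/2`.
* `IsingEuclidUpgradeR2RotInvPowerLaw_of_zoomMonotone_of_etaBounds : ZoomMonotone → EtaBoundsExist → r2`,
  through the landed glue `IsingEuclidUpgradeR2RotInvPowerLaw_of_towerLaw_of_rayLaw`.

So 0634 ⟸ 14454 ∧ 4662. References: H. Duminil-Copin, ICM 2022, §8.1/§8.4 [DuminilCopinICM2022];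
M. Aizenman, H. Duminil-Copin, Ann. Math. 194 (2021), Remark 5.10 [AizenmanDuminilCopinAnnals2021] (doubling /
regular scales). No definitions are introduced; items 14454 and 4662 enter as hypotheses only.
-/

noncomputable section

namespace Summit.CriticalPhenomena.Ising3DConformalLimit.Cruxes.IsingEuclidUpgradeR2RotInvPowerLaw.TowerProfileRigidity

open Filter Topology Literature.Probability.LatticeModels
open Summit.CriticalPhenomena.Ising3DConformalLimit.MoebiusLimitExistsOnlyInteraction (rhoPin)
open Summit.CriticalPhenomena.Ising3DConformalLimit.MoebiusLimitExistsNegative (rescaled_pin_cfg0s)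
open Summit.CriticalPhenomena.Ising3DConformalLimit.Cruxes.ExistsScaleCovariantLimit.TwoHierarchies
  (crux_of_zoomMonotone cfg0_two_mem cfg0_two_intCoord)
open Summit.CriticalPhenomena.Ising3DConformalLimit.HarmonicMomentsIsotropyTwoPoint.RayRV
  (rayRV_of_existsScaleCovariantLimit)

/-! ### 14454 ⇒ Sray -/

/-- **MONOTONE-RG LINK, rays (registered): item 14454 `ZoomMonotone` ⇒ Sray.** Eventual monotonicity of
the self-normalised critical zoom at integer configurations gives the scale-covariant continuum limit
(tree `crux_of_zoomMonotone`), hence ray regular variation of `⟨σ₀σ_x⟩_{β_c}` on `ℤ³`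
(`rayRV_of_existsScaleCovariantLimit`), which is the ray dilation law with `Δ = a/2` (`rayLaw_of_rayRV`).
[cite: DuminilCopinICM2022, §8.4] -/
theorem rayDilationLaw_of_zoomMonotone : Summit.CriticalPhenomena.Ising3DConformalLimit.Theses.MonotoneRG.ZoomMonotone → ∃ Δ : ℝ, ∀ v : Literature.Probability.LatticeModels.Site 3, v ≠ 0 → ∀ k : ℕ, 1 ≤ k → Filter.Tendsto (fun n : ℕ => Literature.Probability.LatticeModels.criticalTwoPoint 3 (((k * n : ℕ) : ℤ) • v) * (k : ℝ) ^ (2 * Δ) / Literature.Probability.LatticeModels.criticalTwoPoint 3 (((n : ℕ) : ℤ) • v)) Filter.atTop (nhds 1) :=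
  fun hZ => rayLaw_of_rayRV (rayRV_of_existsScaleCovariantLimit (crux_of_zoomMonotone hZ))

/-! ### 14454 ∧ 4662 ⇒ T1 -/

/-- A positive real sequence pinched in `[c, C]` (`c > 0`) whose successive ratios `r_j = u_{j+1}/u_j` are
eventually monotone converges to a positive limit: if the ratios are nondecreasing from `J` on and some
`r_j > 1`, then `u_{j+n} ≥ r_j^n u_j → ∞`; so `r_j ≤ 1` from `J` on, `u` is eventually nonincreasing and
bounded below by `c`; dually in the nonincreasing case. [folklore] -/
private theorem tendsto_of_pinched_of_ratio_eventually_monotone {u r : ℕ → ℝ} {c C : ℝ} {J : ℕ}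
    (hc : 0 < c) (hlo : ∀ j, c ≤ u j) (hhi : ∀ j, u j ≤ C) (hrec : ∀ j, u (j + 1) = r j * u j)
    (hmono : MonotoneOn r (Set.Ici J) ∨ AntitoneOn r (Set.Ici J)) :
    ∃ L : ℝ, 0 < L ∧ Tendsto u atTop (𝓝 L) := by
  have upos : ∀ j, 0 < u j := fun j => hc.trans_le (hlo j)
  have rpos : ∀ j, 0 < r j := by
    intro j
    have h := upos (j + 1)
    rw [hrec] at h
    exact pos_of_mul_pos_left h (upos j).le
  -- geometric comparison along a stretch where the ratios dominate / are dominated by `r j`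
  have hgeom_lo : ∀ j, (∀ n, r j ≤ r (j + n)) → ∀ n, r j ^ n * u j ≤ u (j + n) := by
    intro j hj n
    induction n with
    | zero => simp
    | succ n ih =>
      calc r j ^ (n + 1) * u j = r j * (r j ^ n * u j) := by ring
        _ ≤ r j * u (j + n) := mul_le_mul_of_nonneg_left ih (rpos j).le
        _ ≤ r (j + n) * u (j + n) := mul_le_mul_of_nonneg_right (hj n) (upos _).le
        _ = u (j + (n + 1)) := by rw [← add_assoc, hrec]
  have hgeom_hi : ∀ j, (∀ n, r (j + n) ≤ r j) → ∀ n, u (j + n) ≤ r j ^ n * u j := by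
    intro j hj n
    induction n with
    | zero => simp
    | succ n ih =>
      calc u (j + (n + 1)) = r (j + n) * u (j + n) := by rw [← add_assoc, hrec]
        _ ≤ r j * u (j + n) := mul_le_mul_of_nonneg_right (hj n) (upos _).le
        _ ≤ r j * (r j ^ n * u j) := mul_le_mul_of_nonneg_left ih (rpos j).le
        _ = r j ^ (n + 1) * u j := by ring
  -- the shifted sequence `v n = u (n + J)` is monotone or antitone
  set v : ℕ → ℝ := fun n => u (n + J) with hv
  have hv_cases : Antitone v ∨ Monotone v := by
    rcases hmono with hm | ha
    · -- nondecreasing ratios: all `r j ≤ 1` from `J` on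
      left
      refine antitone_nat_of_succ_le fun n => ?_
      have hJ : J ≤ n + J := Nat.le_add_left J n
      have hr1 : r (n + J) ≤ 1 := by
        by_contra h1
        push Not at h1
        have hdom : ∀ i, r (n + J) ≤ r (n + J + i) := fun i =>
          hm (Set.mem_Ici.2 hJ) (Set.mem_Ici.2 (hJ.trans (Nat.le_add_right _ _))) (Nat.le_add_right _ _)
        have ht : Tendsto (fun i => r (n + J) ^ i * u (n + J)) atTop atTop :=
          (tendsto_pow_atTop_atTop_of_one_lt h1).atTop_mul_const (upos _)
        obtain ⟨i, hi⟩ := (ht.eventually_gt_atTop C).exists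
        exact absurd ((hi.trans_le (hgeom_lo _ hdom i)).trans_le (hhi _)) (lt_irrefl C)
      show u (n + 1 + J) ≤ u (n + J)
      rw [show n + 1 + J = n + J + 1 by ring, hrec]
      calc r (n + J) * u (n + J) ≤ 1 * u (n + J) := mul_le_mul_of_nonneg_right hr1 (upos _).le
        _ = u (n + J) := one_mul _
    · -- nonincreasing ratios: all `1 ≤ r j` from `J` on
      right
      refine monotone_nat_of_le_succ fun n => ?_
      have hJ : J ≤ n + J := Nat.le_add_left J n
      have hr1 : 1 ≤ r (n + J) := by
        by_contra h1
        push Not at h1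
        have hdom : ∀ i, r (n + J + i) ≤ r (n + J) := fun i =>
          ha (Set.mem_Ici.2 hJ) (Set.mem_Ici.2 (hJ.trans (Nat.le_add_right _ _))) (Nat.le_add_right _ _)
        have ht : Tendsto (fun i => r (n + J) ^ i * u (n + J)) atTop (𝓝 (0 * u (n + J))) :=
          (tendsto_pow_atTop_nhds_zero_of_lt_one (rpos _).le h1).mul_const _
        rw [zero_mul] at ht
        obtain ⟨i, hi⟩ := (ht.eventually (gt_mem_nhds hc)).exists
        exact absurd (((hlo _).trans (hgeom_hi _ hdom i)).trans_lt hi) (lt_irrefl c)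
      show u (n + J) ≤ u (n + 1 + J)
      rw [show n + 1 + J = n + J + 1 by ring, hrec]
      calc u (n + J) = 1 * u (n + J) := (one_mul _).symm
        _ ≤ r (n + J) * u (n + J) := mul_le_mul_of_nonneg_right hr1 (upos _).le
  -- monotone + bounded ⇒ convergent, with a limit `≥ c > 0`
  have hbelow : BddBelow (Set.range v) := ⟨c, by rintro _ ⟨n, rfl⟩; exact hlo _⟩
  have habove : BddAbove (Set.range v) := ⟨C, by rintro _ ⟨n, rfl⟩; exact hhi _⟩
  rcases hv_cases with hanti | hmon
  · refine ⟨⨅ n, v n, hc.trans_le (le_ciInf fun n => hlo _), ?_⟩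
    exact (tendsto_add_atTop_iff_nat J).1 (tendsto_atTop_ciInf hanti hbelow)
  · refine ⟨⨆ n, v n, hc.trans_le ((hlo (0 + J)).trans (le_ciSup habove 0)), ?_⟩
    exact (tendsto_add_atTop_iff_nat J).1 (tendsto_atTop_ciSup hmon habove)

/-- **The self-normalised pair zoom at `(0, 2e₀)` and mesh `1/m` is the doubling ratio `g(2m)/g(m)`**
(route `MonotoneRG`'s forced renormalisation `ρ★(δ) = g(⌊δ⁻¹⌋)^{-1/2}` is the pinned one, and
`⌊2/(1/m)⌋ = 2m`, `⌊1/(1/m)⌋ = m`). [folklore] -/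
private theorem zoom_cfg0_two_inv_nat (m : ℕ) :
    rescaledCorrelator (criticalCorr 3)
        (fun δ : ℝ => (criticalTwoPoint 3 (Pi.single 0 ⌊δ⁻¹⌋)) ^ (-(1/2:ℝ))) 2 (1 / (m : ℝ))
        (![0, EuclideanSpace.single 0 (2:ℝ)] : Fin 2 → EuclideanSpace ℝ (Fin 3)) =
      criticalTwoPoint 3 (Pi.single 0 ((2 * m : ℕ) : ℤ)) / criticalTwoPoint 3 (Pi.single 0 ((m : ℕ) : ℤ)) := by
  have hρ : (fun δ : ℝ => (criticalTwoPoint 3 (Pi.single 0 ⌊δ⁻¹⌋)) ^ (-(1/2:ℝ))) = rhoPin :=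
    funext fun δ => by simp only [rhoPin, one_div]
  rw [hρ, rescaled_pin_cfg0s]
  have h1 : (2:ℝ) / (1 / (m : ℝ)) = (((2 * m : ℕ) : ℤ) : ℝ) := by
    rw [div_div_eq_mul_div, div_one]; push_cast; ring
  have h2 : (1:ℝ) / (1 / (m : ℝ)) = (((m : ℕ) : ℤ) : ℝ) := by
    rw [one_div_one_div]; push_cast; ring
  rw [h1, h2, Int.floor_intCast, Int.floor_intCast]

/-- **14454 ∧ (two-sided power bounds with exponent `κ`) ⇒ the tower `g(2^j)(2^j)^κ` converges to a positive
limit.** `u_j := g(2^j)(2^j)^κ ∈ [c, C]` by the bounds (`‖2^j e₀‖ = 2^j`); `u_{j+1} = r_j u_j` with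
`r_j = 2^κ g(2^{j+1})/g(2^j)`, eventually monotone in `j` because `m ↦ g(2m)/g(m)` is the self-normalised
pair zoom at `(0, 2e₀)` (`zoom_cfg0_two_inv_nat`) and `ZoomMonotone` applies at that integer configuration;
conclude by `tendsto_of_pinched_of_ratio_eventually_monotone`.
[cite: AizenmanDuminilCopinAnnals2021, Remark 5.10] -/
private theorem towerLaw_of_zoomMonotone_of_powerBounded
    (hZ : Summit.CriticalPhenomena.Ising3DConformalLimit.Theses.MonotoneRG.ZoomMonotone) {κ : ℝ}
    (hP : IsPowerBounded (criticalTwoPoint 3) κ) :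
    ∃ c : ℝ, 0 < c ∧ Tendsto (fun j : ℕ =>
      criticalTwoPoint 3 (Pi.single 0 ((2 ^ j : ℕ) : ℤ)) * ((2 ^ j : ℕ) : ℝ) ^ κ) atTop (𝓝 c) := by
  obtain ⟨c, C, hc, hb⟩ := hP
  set g : ℕ → ℝ := fun n => criticalTwoPoint 3 (Pi.single 0 ((n : ℕ) : ℤ)) with hg
  have gpos : ∀ n, 0 < g n := fun n => criticalTwoPoint_axis_pos n
  -- the bounds on the axis: `c ≤ g(N) N^κ ≤ C` for `N ≥ 1`
  have hnorm : ∀ N : ℕ, ‖(Pi.single 0 ((N : ℕ) : ℤ) : Site 3)‖ = (N : ℝ) := fun N => by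
    rw [norm_single_axis, Int.cast_natCast, Nat.abs_cast]
  have hpinch : ∀ N : ℕ, 1 ≤ N → c ≤ g N * (N : ℝ) ^ κ ∧ g N * (N : ℝ) ^ κ ≤ C := by
    intro N hN
    have hN0 : (0 : ℝ) < N := by exact_mod_cast hN
    have hne : (Pi.single 0 ((N : ℕ) : ℤ) : Site 3) ≠ 0 := by
      intro h
      have h' := congrArg (fun x : Site 3 => ‖x‖) h
      simp only [hnorm, norm_zero] at h'
      exact absurd h' hN0.ne'
    obtain ⟨h1, h2⟩ := hb _ hne
    rw [hnorm] at h1 h2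
    have hpow : (N : ℝ) ^ (-κ) * (N : ℝ) ^ κ = 1 := by
      rw [Real.rpow_neg hN0.le, inv_mul_cancel₀ (Real.rpow_pos_of_pos hN0 κ).ne']
    have hκ0 : 0 ≤ (N : ℝ) ^ κ := (Real.rpow_pos_of_pos hN0 κ).le
    constructor
    · calc c = c * (N : ℝ) ^ (-κ) * (N : ℝ) ^ κ := by rw [mul_assoc, hpow, mul_one]
        _ ≤ g N * (N : ℝ) ^ κ := mul_le_mul_of_nonneg_right h1 hκ0
    · calc g N * (N : ℝ) ^ κ ≤ C * (N : ℝ) ^ (-κ) * (N : ℝ) ^ κ := mul_le_mul_of_nonneg_right h2 hκ0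
        _ = C := by rw [mul_assoc, hpow, mul_one]
  -- the tower sequence and its ratios
  set u : ℕ → ℝ := fun j => g (2 ^ j) * ((2 ^ j : ℕ) : ℝ) ^ κ with hu
  set r : ℕ → ℝ := fun j => g (2 * 2 ^ j) / g (2 ^ j) * (2 : ℝ) ^ κ with hr
  have hlo : ∀ j, c ≤ u j := fun j => (hpinch (2 ^ j) Nat.one_le_two_pow).1
  have hhi : ∀ j, u j ≤ C := fun j => (hpinch (2 ^ j) Nat.one_le_two_pow).2
  have hrec : ∀ j, u (j + 1) = r j * u j := by
    intro j
    have h2j : (0 : ℝ) ≤ ((2 ^ j : ℕ) : ℝ) := by positivity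
    have hcast : ((2 ^ (j + 1) : ℕ) : ℝ) = 2 * ((2 ^ j : ℕ) : ℝ) := by push_cast; ring
    have hgj : g (2 ^ j) ≠ 0 := (gpos _).ne'
    simp only [hu, hr]
    rw [hcast, Real.mul_rpow (by norm_num : (0:ℝ) ≤ 2) h2j, pow_succ']
    field_simp
  -- eventual monotonicity of the ratios from `ZoomMonotone` at `(0, 2e₀)`
  obtain ⟨m₀, hmono⟩ := hZ 2 _ cfg0_two_mem cfg0_two_intCoord
  have hzoom : ∀ m : ℕ, rescaledCorrelator (criticalCorr 3)
      (fun δ : ℝ => (criticalTwoPoint 3 (Pi.single 0 ⌊δ⁻¹⌋)) ^ (-(1/2:ℝ))) 2 (1 / (m : ℝ))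
      (![0, EuclideanSpace.single 0 (2:ℝ)] : Fin 2 → EuclideanSpace ℝ (Fin 3)) = g (2 * m) / g m :=
    fun m => zoom_cfg0_two_inv_nat m
  simp only [hzoom] at hmono
  have hmem : ∀ i : ℕ, m₀ ≤ i → 2 ^ i ∈ Set.Ici m₀ := fun i hi =>
    Set.mem_Ici.2 (hi.trans (Nat.lt_two_pow_self).le)
  have h2κ : 0 ≤ (2 : ℝ) ^ κ := (Real.rpow_pos_of_pos (by norm_num) κ).le
  have hrmono : MonotoneOn r (Set.Ici m₀) ∨ AntitoneOn r (Set.Ici m₀) := by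
    rcases hmono with hm | ha
    · left
      intro i hi j hj hij
      exact mul_le_mul_of_nonneg_right
        (hm (hmem i hi) (hmem j hj) (Nat.pow_le_pow_right (by norm_num) hij)) h2κ
    · right
      intro i hi j hj hij
      exact mul_le_mul_of_nonneg_right
        (ha (hmem i hi) (hmem j hj) (Nat.pow_le_pow_right (by norm_num) hij)) h2κ
  exact tendsto_of_pinched_of_ratio_eventually_monotone hc hlo hhi hrec hrmono

/-- **MONOTONE-RG LINK, tower (registered): items 14454 `ZoomMonotone` ∧ 4662 `EtaBoundsExist` ⇒ T1.**
With `κ := 1 + η` from the η-bounds, the normalised tower `g(2^j)(2^j)^κ` is pinched in `[c, C]` and its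
successive ratios `2^κ g(2^{j+1})/g(2^j)` are eventually monotone (`ZoomMonotone` at the integer pair
`(0, 2e₀)`), hence it converges to some `c★ ≥ c > 0`: the dyadic tower law with `Δ = κ/2`.
[cite: DuminilCopinICM2022, §8.1] -/
theorem towerLaw_of_zoomMonotone_of_etaBounds : Summit.CriticalPhenomena.Ising3DConformalLimit.Theses.MonotoneRG.ZoomMonotone → Summit.CriticalPhenomena.Ising3DConformalLimit.Theses.HelsonAxis.EtaBoundsExist → ∃ Δ c : ℝ, 0 < c ∧ Filter.Tendsto (fun j : ℕ => Literature.Probability.LatticeModels.criticalTwoPoint 3 (Pi.single 0 ((2 ^ j : ℕ) : ℤ)) * ((2 ^ j : ℕ) : ℝ) ^ (2 * Δ)) Filter.atTop (nhds c) := by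
  intro hZ hE
  obtain ⟨η, hη⟩ := hE
  obtain ⟨c, hc, h⟩ := towerLaw_of_zoomMonotone_of_powerBounded hZ hη
  refine ⟨((3 : ℕ) - 2 + η : ℝ) / 2, c, hc, ?_⟩
  have e : 2 * ((((3 : ℕ) : ℝ) - 2 + η) / 2) = ((3 : ℕ) : ℝ) - 2 + η := by ring
  simpa only [e] using h

/-! ### 14454 ∧ 4662 ⇒ r2 -/

/-- **MONOTONE-RG LINK (registered): items 14454 `ZoomMonotone` ∧ 4662 `EtaBoundsExist` ⇒ the crux r2**
`IsingEuclidUpgradeR2RotInvPowerLaw` (isotropic pure power law of `⟨σ₀σ_x⟩_{β_c}` on `ℤ³`), through the landed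
radial glue `T1 → Sray → r2`. [cite: DuminilCopinICM2022, §8.1] -/
theorem IsingEuclidUpgradeR2RotInvPowerLaw_of_zoomMonotone_of_etaBounds : Summit.CriticalPhenomena.Ising3DConformalLimit.Theses.MonotoneRG.ZoomMonotone → Summit.CriticalPhenomena.Ising3DConformalLimit.Theses.HelsonAxis.EtaBoundsExist → Summit.CriticalPhenomena.Ising3DConformalLimit.Theses.IsingEuclidUpgrade.IsingEuclidUpgradeR2RotInvPowerLaw :=
  fun hZ hE => IsingEuclidUpgradeR2RotInvPowerLaw_of_towerLaw_of_rayLaw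
    (towerLaw_of_zoomMonotone_of_etaBounds hZ hE) (rayDilationLaw_of_zoomMonotone hZ)

end Summit.CriticalPhenomena.Ising3DConformalLimit.Cruxes.IsingEuclidUpgradeR2RotInvPowerLaw.TowerProfileRigidity

end
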